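import Literature.AnabelianGeometry.EtaleTheta.DivisorMonoidsOfGaloisCoveringConnected
import Literature.AnabelianGeometry.EtaleTheta.RealifiedDivisorMonoidsOfRlfWeak
import Literature.AnabelianGeometry.EtaleTheta.RealificationPfImageWeak
import Literature.AnabelianGeometry.EtaleTheta.TemperedFrobenioidRestrict
import Literature.AnabelianGeometry.EtaleTheta.Discharge.Sec3Prop34iPhiZero
import Literature.AnabelianGeometry.EtaleTheta.Discharge.Sec3Example39DataNonVacuity
import Literature.AnabelianGeometry.EtaleTheta.Discharge.Sec3Cor38CriterionToy
import HarnessLib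

/-!
# [EtTh] Def 3.6 (ii): a tempered Frobenioid over the CONSTRUCTED Def 3.3 (iii) data of the connected coverings
# (`DivisorMonoids.ofGaloisActionConnected A hZ`, WEAK vocabulary of record) at ANY rank-one point — generic NV engine

S. Mochizuki, *The étale theta function and its Frobenioid-theoretic manifestations*, Publ. RIMS **45** (2009)
[MochizukiEtTh2009], Def. 3.3 (iii) PDF p. 73; Def. 3.6 (i)(ii) pp. 76–77 ("Let `D` be a connected, totally epimorphic
category, equipped with a functor `D → D₀`; `Φ ⊆ Φ^{ℝ-log} := Φ₀^ℝ|_D` a group-saturated subfunctor in monoids which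
determines a perf-factorial divisorial monoid on `D` such that (a) `Φ^{bs-fld} := (ℝ·Φ₀^cnst)|_D ×_{(Φ^{ℝ-log})^gp} Φ` is
monoprime; (b) … `F(A) → (Φ^{bs-fld})^gp(A)` is nonzero … the data `(D, Φ, B, B → Φ^gp)` determines a model Frobenioid `C`")
[cite: MochizukiEtTh2009, Def 3.6 p.77]; Rmk. 3.6.1 / Example 3.9 (the case of a single point of `D₀`: the `p`-adic
Frobenioid of the base field, [FrdII] Ex. 1.1).

abc-iut cell, block C / W6, seat abc-iut-w6-d048 (gen 3).  CLASS (b) MODEL / NON-VACUITY engine (one `def` producing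
Def. 3.6 (ii) data + one re-basing `def`; landed declarations consumed BY NAME: abc-iut-w6-d058's
`DivisorMonoids.ofGaloisActionConnected`, abc-iut-L6-t12's `RealifiedDivisorMonoids.ofRlfZWeak`, abc-iut-L2-d2's
`PfImageWeak.*`, abc-iut-w5-d164's `Toy.temperedFrobenioid.isConnected/isTotallyEpimorphic`, `Cor38Toy.isMonoidOn_of_punit`,
this seat's `TemperedFrobenioid.restrictConnectedPart`).

WHY (cell finding F-w6d048g3-1): the tree's theorems "for EVERY tempered Frobenioid over the constructed connected data"
(abc-iut-w5-d179's Thm. 4.4 / Def. 3.6 (ii) / Thm. 3.7 files, this seat's `Λ = ℝ` files) quantify over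
`TemperedFrobenioid (ofRlfZWeak (ofGaloisActionConnected A hZ) hpf) D VD`; until now NO inhabitant of that class existed for
any `(Z, G, A, hZ)` (the only `LogDivisorModel` was the degenerate `toy`, `DIV = 1`, over which Def. 3.6 (ii)(b) is
unsatisfiable).  THIS FILE builds one for EVERY `(Z, G, A, hZ)` possessing a RANK-ONE POINT:
* INPUT (`RankOnePoint A S₀`): a connected `G`-set `S₀` (a connected covering `Y₀` dominated by `Z_∞`) with an
  isomorphism `e : Φ₀(S₀) ≃* ℕ` (one Galois orbit of prime log-divisors on `Z_∞` over `Y₀`: e.g. `Y₀ = X` itself when the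
  special fibre of `Z_∞` is one `Gal(Z_∞/X)`-orbit — smooth reduction, or the Tate tower) such that every log-divisor over
  `S₀` is the divisor of a CONSTANT function (`hcnst`: `Φ₀(S₀) ⊆ div₀(F₀(S₀))`, e.g. `[fibre] = div₀(ϖ)`);
* OUTPUT: **`TemperedFrobenioid.ofRankOnePoint`** `: TemperedFrobenioid (ofRlfZWeak (ofGaloisActionConnected A hZ) hpf)
  (Discrete PUnit) (treeCatVocab …)` — Def. 3.6 (ii) with `D = {pt} → D₀`, `pt ↦ S₀`, `Φ := im(Φ₀(S₀)^pf → Φ₀(S₀)^rlf)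
  ≅ ℚ_{≥0}` inside `Φ^{ℝ-log} = Φ₀(S₀)^rlf` (group-saturated / perf-factorial (weak) / divisorial: `PfImageWeak.*`); (a)
  `Φ^{bs-fld} = Φ` monoprime (by `hcnst` every class of `Φ` lies in `ℝ·Φ₀^cnst`, root-closed); (b) the constant `b₁` with
  `div₀ b₁ = e⁻¹(1)` lies in `F₀ = F₀^ℤ` and has divisor `ι(e⁻¹ 1)/1 ≠ 1` — print's `p`-adic Frobenioid of the field of
  constants of `Y₀` ([FrdII] Ex. 1.1), LITERALLY over the constructed data; `ofRankOnePointConnectedPart` — re-based to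
  print's genuine base `B^temp(Π)⁰` for every topological group `Π` (constant functor to the point);
  `nonempty_…` / `isFrobenioid_…` ([FrdI] Thm. 5.2 (ii)).
Instances: the one-component model (`LogDivisorModelOneComponent.lean`, smooth reduction, `G = 1`, `S₀ = pt`) and
abc-iut-w6-d058's Tate-tower model (`S₀ = G/G`) — separate small files.
HONEST LABEL: genuine vocabularies and the constructed data; the witness lives over ONE point of `D₀` (`D` one object) —
an instantiation / consistency witness, not the tempered Frobenioid of the whole tower; Def. 4.1 bi-Kummer data are NOT
claimed inhabited.  Nothing here bears on [IUTchIII] Cor. 3.12; no side taken; typed ≠ proved for anything else.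
-/

noncomputable section

namespace Literature.AnabelianGeometry.EtaleTheta

open CategoryTheory Opposite Function Literature.AlgebraicGeometry.Frobenioids
  Literature.AnabelianGeometry.SemiGraphs LogDivisorModel LogDivisorModel.GaloisAction

namespace TemperedFrobenioid

/-- **A rank-one point of the Def. 3.3 (iii) data**: a connected covering `S₀` whose `Φ₀(S₀)` is `≅ ℕ` (one Galois orbit of
prime log-divisors) and over which every log-divisor is the divisor of a constant function (`Φ₀^birat = Φ₀^cnst = Φ₀^gp`).
[cite: MochizukiEtTh2009, Def 3.3 p.73] -/
structure RankOnePoint {Z : LogDivisorModel.{0}} {G : Type} [Group G] (A : Z.GaloisAction G) : Type 1 where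
  /-- the connected covering `Y₀` (a nonempty transitive `G`-set) -/
  S₀ : (isConnectedGSet (G := G)).FullSubcategory
  /-- `Φ₀(S₀) ≅ ℕ` -/
  e : A.phiZero S₀.obj ≃* Multiplicative ℕ
  /-- every log-divisor over `S₀` is the divisor of a constant log-meromorphic function -/
  hcnst : ∀ m : A.phiZero S₀.obj, ∃ b ∈ A.fZero S₀.obj, A.divZeroHom S₀.obj b = Algebra.GrothendieckGroup.of m

variable {Z : LogDivisorModel.{0}} {G : Type} [Group G] {A : Z.GaloisAction G} (hZ : Z.CuspLaws) (P : RankOnePoint A)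
  (hpf : ∀ Y : ((isConnectedGSet (G := G)).FullSubcategory)ᵒᵖ,
    IsPerfFactorialCof ((DivisorMonoids.ofGaloisActionConnected A hZ).Φ₀.obj Y))

namespace RankOnePoint

/-- `Φ₀(S₀)` is monoprime. [cite: MochizukiEtTh2009, Rmk 3.3.1 p.73] -/
theorem isMonoprime_Φ₀ : IsMonoprime ((DivisorMonoids.ofGaloisActionConnected A hZ).Φ₀.obj (op P.S₀)) :=
  IsMonoprime.of_mulEquiv P.e.symm isMonoprime_multiplicative_nat

/-- `Φ₀(S₀)` is perf-factorial in the PRINTED sense (monoprime ⇒ perf-factorial). [cite: MochizukiEtTh2009, Prop 3.4 p.74] -/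
theorem isPerfFactorial_Φ₀ : IsPerfFactorial ((DivisorMonoids.ofGaloisActionConnected A hZ).Φ₀.obj (op P.S₀)) :=
  MonoprimeStructure.isPerfFactorial (P.isMonoprime_Φ₀ hZ)

/-- The weak Def. 3.6 (i) data of monoid type `ℤ` over the constructed connected data (data of record).
[cite: MochizukiEtTh2009, Def 3.6 p.76] -/
abbrev T : RealifiedDivisorMonoids (D₀ := (isConnectedGSet (G := G)).FullSubcategory) treeMonoidVocabWeak.{0} :=
  RealifiedDivisorMonoids.ofRlfZWeak (DivisorMonoids.ofGaloisActionConnected A hZ) hpf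

/-- The base functor `{pt} → D₀`, `pt ↦ S₀`. [cite: MochizukiEtTh2009, Def 3.6 p.76] -/
abbrev base : Discrete PUnit.{1} ⥤ (isConnectedGSet (G := G)).FullSubcategory :=
  (Functor.const (Discrete PUnit.{1})).obj P.S₀

/-- `Φ := im(Φ₀(S₀)^pf → Φ₀(S₀)^rlf)` (weak realification map). [cite: MochizukiEtTh2009, Def 3.6 p.76] -/
def pfImage : Submonoid ((T hZ hpf).ΦR.obj (op P.S₀)) :=
  MonoidHom.mrange (hpf (op P.S₀)).weak.toRealification

/-- Every element of `Φ` is base-field-theoretic: its class lies in `ℝ·Φ₀^cnst(S₀)` (by `hcnst` and root-closure).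
[cite: MochizukiEtTh2009, Def 3.6 p.77] -/
theorem of_mem_cnstR_of_mem_pfImage {x : (T hZ hpf).ΦR.obj (op P.S₀)} (hx : x ∈ P.pfImage hZ hpf) :
    Algebra.GrothendieckGroup.of x ∈ (T hZ hpf).cnstR (op P.S₀) := by
  obtain ⟨a, rfl⟩ := hx
  obtain ⟨⟨m, n⟩, rfl⟩ := Perfection.mk_surjective a
  apply (T hZ hpf).mem_cnstR_of_pow_mem _ n.ne_zero
  rw [← map_pow, ← map_pow, Perfection.mk_pow_self]
  obtain ⟨b, hb, hbm⟩ := P.hcnst m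
  have key : EtaleTheta.gpMap ((T hZ hpf).toR (op P.S₀))
      ((DivisorMonoids.ofGaloisActionConnected A hZ).div₀ (op P.S₀) b) ∈ (T hZ hpf).cnstR (op P.S₀) :=
    (T hZ hpf).cnst_le_cnstR (op P.S₀) b hb
  have h : EtaleTheta.gpMap ((T hZ hpf).toR (op P.S₀)) ((DivisorMonoids.ofGaloisActionConnected A hZ).div₀ (op P.S₀) b) =
      Algebra.GrothendieckGroup.of ((hpf (op P.S₀)).weak.toRealification (Perfection.of _ m)) := by
    rw [show (DivisorMonoids.ofGaloisActionConnected A hZ).div₀ (op P.S₀) b = Algebra.GrothendieckGroup.of m from hbm]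
    exact EtaleTheta.gpMap_of _ _
  exact (congrArg (· ∈ (T hZ hpf).cnstR (op P.S₀)) h).mp key

/-- `Φ ∩ ℝ·Φ₀^cnst = Φ` ("`Φ^{bs-fld} = Φ`"). [cite: MochizukiEtTh2009, Def 3.6 p.77] -/
theorem pfImage_inf_cnstR_eq :
    P.pfImage hZ hpf ⊓ ((T hZ hpf).cnstR (op P.S₀)).toSubmonoid.comap Algebra.GrothendieckGroup.of = P.pfImage hZ hpf :=
  inf_eq_left.mpr fun _ hx => P.of_mem_cnstR_of_mem_pfImage hZ hpf hx

/-- `Φ` is monoprime (`≅ Φ₀(S₀)^pf ≅ ℚ_{≥0}`; the weak and the printed realification maps coincide on the nose for the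
perf-factorial `Φ₀(S₀)`). [cite: MochizukiEtTh2009, Def 3.6 p.77] -/
theorem isMonoprime_pfImage : IsMonoprime ↥(P.pfImage hZ hpf) :=
  Example39NV.isMonoprime_mrange_toRealification (P.isMonoprime_Φ₀ hZ)

/-- The generator `ι(e⁻¹ 1) ∈ Φ` is not `1`. [cite: MochizukiEtTh2009, Def 3.6 p.77] -/
theorem toRealification_gen_ne_one :
    (hpf (op P.S₀)).weak.toRealification (Perfection.of _ (P.e.symm (Multiplicative.ofAdd 1))) ≠ 1 := by
  intro h
  have h1 := PfImageWeak.toRealification_injective (hpf (op P.S₀)).weak (h.trans (map_one _).symm)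
  have h2 : P.e.symm (Multiplicative.ofAdd 1) = 1 :=
    (Perfection.mk_eq_one_iff_of_isSharp (MonoprimeStructure.isSharp (P.isMonoprime_Φ₀ hZ))).mp h1
  have h3 : (Multiplicative.ofAdd (1 : ℕ) : Multiplicative ℕ) = 1 := by
    rw [← P.e.apply_symm_apply (Multiplicative.ofAdd 1), h2, map_one]
  exact one_ne_zero (ofAdd_eq_one.mp h3)

/-- `Φ ⊆ Φ^{ℝ-log}|_D` as a subfunctor in monoids over the constant base functor. [cite: MochizukiEtTh2009, Def 3.6 p.76] -/
def Φsub : SubMonoidOn ((P.base).op ⋙ (T hZ hpf).ΦR) where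
  carrier _ := P.pfImage hZ hpf
  map_mem := by
    rintro X Y f _ ⟨a, rfl⟩
    exact ⟨Perfection.map ((DivisorMonoids.ofGaloisActionConnected A hZ).Φ₀.map (P.base.map f.unop).op).hom a,
      (DFunLike.congr_fun (rlfMapWeak_comp_toRealification (DivisorMonoids.ofGaloisActionConnected A hZ).Φ₀ hpf
        (P.base.map f.unop).op) a).symm⟩

end RankOnePoint

variable (R S : ((Discrete PUnit.{1})ᵒᵖ ⥤ CommMonCat.{0}) → Prop)

/-- **Def. 3.6 (ii) data over the CONSTRUCTED connected Def. 3.3 (iii) data at a rank-one point** (monoid type `ℤ`, weak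
vocabulary of record): `D = {pt} ↦ S₀`, `Φ := im(Φ₀(S₀)^pf → Φ₀(S₀)^rlf)`; every condition PROVED — the `p`-adic Frobenioid of
the constant field of `Y₀` ([FrdII] Ex. 1.1). [cite: MochizukiEtTh2009, Def 3.6 p.77] -/
def ofRankOnePoint : TemperedFrobenioid (RankOnePoint.T hZ hpf) (Discrete PUnit.{1}) (treeCatVocab (Discrete PUnit.{1}) R S) where
  isConnected := Toy.temperedFrobenioid.isConnected
  isTotallyEpimorphic := Toy.temperedFrobenioid.isTotallyEpimorphic
  base := P.base
  Φ := P.Φsub hZ hpf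
  isGroupSaturated _ := PfImageWeak.isGroupSaturated_mrange_toRealification (hpf (op P.S₀)).weak
  isPerfFactorial _ := PfImageWeak.isPerfFactorialCof_mrange_toRealification (hpf (op P.S₀))
  isDivisorialOn := by
    rw [treeCatVocab_isDivisorialOn]
    exact ⟨Cor38Toy.isMonoidOn_of_punit _, fun _ => PfImageWeak.isDivisorial_mrange_toRealification (hpf (op P.S₀))⟩
  isMonoprime_bsFld _ :=
    IsMonoprime.of_mulEquiv (MulEquiv.submonoidCongr (P.pfImage_inf_cnstR_eq hZ hpf).symm) (P.isMonoprime_pfImage hZ hpf)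
  exists_FΛ_div_ne _ := by
    obtain ⟨b, hb, hbm⟩ := P.hcnst (P.e.symm (Multiplicative.ofAdd 1))
    refine ⟨b, hb, (hpf (op P.S₀)).weak.toRealification (Perfection.of _ (P.e.symm (Multiplicative.ofAdd 1))), ⟨_, rfl⟩,
      1, one_mem _, P.toRealification_gen_ne_one hZ hpf, ?_⟩
    simp only [map_one, div_one]
    rw [RealifiedDivisorMonoids.ofRlfZWeak_divΛ_apply]
    change EtaleTheta.gpMap _ ((DivisorMonoids.ofGaloisActionConnected A hZ).div₀ (op P.S₀) b) = _
    rw [show (DivisorMonoids.ofGaloisActionConnected A hZ).div₀ (op P.S₀) b = Algebra.GrothendieckGroup.of _ from hbm]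
    exact EtaleTheta.gpMap_of _ _

/-- `Φ` of the witness is `im(Φ₀^pf → Φ₀^rlf)`. [cite: MochizukiEtTh2009, Def 3.6 p.77] -/
@[simp] theorem ofRankOnePoint_Φ_carrier (X : (Discrete PUnit.{1})ᵒᵖ) :
    (ofRankOnePoint hZ P hpf R S).Φ.carrier X = P.pfImage hZ hpf := rfl

/-- The base functor of the witness is constant at `S₀`. [cite: MochizukiEtTh2009, Def 3.6 p.77] -/
@[simp] theorem ofRankOnePoint_base : (ofRankOnePoint hZ P hpf R S).base = P.base := rfl

/-- **NON-VACUITY of the cell's «for every tempered Frobenioid over the constructed connected data» theorems**, at every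
datum with a rank-one point. [cite: MochizukiEtTh2009, Def 3.6 p.77] -/
theorem nonempty_of_rankOnePoint (P₀ : RankOnePoint A) (R₀ S₀ : ((Discrete PUnit.{1})ᵒᵖ ⥤ CommMonCat.{0}) → Prop) :
    Nonempty (TemperedFrobenioid (RealifiedDivisorMonoids.ofRlfZWeak (DivisorMonoids.ofGaloisActionConnected A hZ) hpf)
      (Discrete PUnit.{1}) (treeCatVocab (Discrete PUnit.{1}) R₀ S₀)) :=
  ⟨ofRankOnePoint hZ P₀ hpf R₀ S₀⟩

/-- **The witness IS a Frobenioid** ([FrdI] Thm. 5.2 (ii), abc-iut-found's `ModelFrobenioid.isFrobenioid`: `Φ`, `B` monoids on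
the one-object base, `Φ` divisorial, `B` group-like, `D` connected and totally epimorphic). [cite: MochizukiFrdI2008, Thm. 5.2 (ii) p.100] -/
theorem isFrobenioid_ofRankOnePoint : PreFrobenioid.IsFrobenioid (ofRankOnePoint hZ P hpf R S).toElem :=
  ModelFrobenioid.isFrobenioid (Cor38Toy.isMonoidOn_of_punit _)
    (fun _ => PfImageWeak.isDivisorial_mrange_toRealification (hpf (op P.S₀))) (Cor38Toy.isMonoidOn_of_punit _)
    ((ofRankOnePoint hZ P hpf R S).isGroupLike_ratFnFunctor (RankOnePoint.T hZ hpf).isUnit_BΛ)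
    (isGraphConnected_iff_isConnected.mpr (ofRankOnePoint hZ P hpf R S).isConnected)
    (ofRankOnePoint hZ P hpf R S).isTotallyEpimorphic

section ConnectedPart

variable (Γ : Type) [Group Γ] [TopologicalSpace Γ]
  (R' S' : ((ConnectedPart (BTemp Γ))ᵒᵖ ⥤ CommMonCat.{0}) → Prop)

/-- **The same witness re-based to print's GENUINE base `B^temp(Π)⁰`** (this seat's `restrictConnectedPart` along the constant
functor to the point): an inhabitant of the `…_connectedPart_bTemp` theorem family, for EVERY topological group `Π`.
[cite: MochizukiEtTh2009, Def 3.6 p.77] -/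
def ofRankOnePointConnectedPart :
    TemperedFrobenioid (RankOnePoint.T hZ hpf) (ConnectedPart (BTemp Γ))
      (treeCatVocab (ConnectedPart (BTemp Γ)) R' S') :=
  (ofRankOnePoint hZ P hpf R S).restrictConnectedPart Γ ((Functor.const _).obj ⟨PUnit.unit⟩) R' S'

/-- Non-vacuity over the genuine base. [cite: MochizukiEtTh2009, Def 3.6 p.77] -/
theorem nonempty_of_rankOnePoint_connectedPart (P₀ : RankOnePoint A)
    (R₁ S₁ : ((ConnectedPart (BTemp Γ))ᵒᵖ ⥤ CommMonCat.{0}) → Prop) :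
    Nonempty (TemperedFrobenioid (RealifiedDivisorMonoids.ofRlfZWeak (DivisorMonoids.ofGaloisActionConnected A hZ) hpf)
      (ConnectedPart (BTemp Γ)) (treeCatVocab (ConnectedPart (BTemp Γ)) R₁ S₁)) :=
  ⟨ofRankOnePointConnectedPart hZ P₀ hpf (fun _ => True) (fun _ => True) Γ R₁ S₁⟩

end ConnectedPart

end TemperedFrobenioid

end Literature.AnabelianGeometry.EtaleTheta

end
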